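import Summits.BirchSwinnertonDyer.BirchSwinnertonDyer.Theorems.KolyvaginDepthDoorMSymbolCertCosetsC
import HarnessLib

/-!
# Route `KolyvaginDepthDoor`, crux `KolyvaginDepthSupplyKN` (stmt-BirchSwinnertonDyer-22820) —
# DEPTH TABLE v30, KIT 1″ (prime-power factor): `ℙ¹(ℤ/q^k)` indexed by `{0, …, q^k + q^{k-1} − 1}`

Helper file of the lead prover of line `levelone` (kdd-p1 g35; `--supports stmt-BirchSwinnertonDyer-22820
--as helper`); it closes nothing and BSD is NOT proved by it.

Kit 1 (`…MSymbolCertCosets`, g31) indexes `ℙ¹(ℤ/N)` for PRIME `N` and kit 1′ (`…MSymbolCertCosetsC`, g33) the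
product of two distinct primes; the three rank-two curves `664a1`, `916c1`, `944e1` (`N = 8·83, 4·229, 16·59`) need a
PRIME-POWER factor. This file indexes `ℙ¹(ℤ/q^k)` (`q` prime) by `{0, …, q^k + q^k/q − 1}`: `i < q^k` is the
column `(1 : i)`, `q^k ≤ i` the column `(q (i − q^k) : 1)` — a unimodular column `(a : c)` has `a` a unit (then
`(a : c) ~ (1 : c a⁻¹)`) or else `q ∣ a`, `c` a unit and `(a : c) ~ (a c⁻¹ : 1)` with `q ∣ a c⁻¹`; inverses are
Euler powers `x^{φ(q^k) − 1}`, `φ(q^k) = q^k − q^k/q`.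
* §1 computable layer `idxQN`, `colQN`, `actQN`, `iotaQN` (`ℤ`/`ℕ` arithmetic only);
* §2 `idxQ`, `colQ`, `colUQ`, `mk_eq_mk_colUQ` (every unimodular column is equivalent to the column of its index),
  `idxQ_lt`; agreement `idxQN_eq_idxQ`, `colQ_eq`, `actQN_eq`, `iotaQN_eq`.
(The pair level `q^k · q₂` is the sibling `…MSymbolCertCosetsCQ`.)

References: [CremonaAlgorithms1997] §2.2 (Prop. 2.2.1, `ℙ¹(ℤ/N)` for general `N`); [PopaZagier2017] §5.
-/

set_option linter.dupNamespace false

noncomputable section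

open scoped MatrixGroups ModularForm
open CongruenceSubgroup ModularGroup Matrix
open Literature.NumberTheory.EllipticCurves Literature.NumberTheory.EllipticCurves.ModularForms

namespace Summit.BirchSwinnertonDyer.BirchSwinnertonDyer.Theorems.KolyvaginDepthDoor.MSymbolCert

/-! ## §1 The computable layer -/

section QDefs

variable (q k : ℕ)

/-- The index of the integer column `(a, c)` modulo `q^k` (`q` prime), `ℕ`-arithmetic only: with `a' = a mod q^k`,
`c' = c mod q^k` and `e = φ(q^k) − 1`: `c' a'^e mod q^k` if `(a', q^k) = 1`, else `q^k + (a' c'^e mod q^k) / q`.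
[cite: CremonaAlgorithms1997, §2.2] -/
def idxQN (a c : ℤ) : ℕ :=
  if Nat.Coprime (a % (q ^ k : ℕ)).toNat (q ^ k) then
    ((c % (q ^ k : ℕ)).toNat * (a % (q ^ k : ℕ)).toNat ^ (q ^ k - q ^ k / q - 1)) % q ^ k
  else q ^ k + ((a % (q ^ k : ℕ)).toNat * (c % (q ^ k : ℕ)).toNat ^ (q ^ k - q ^ k / q - 1)) % q ^ k / q

/-- The integer column of an index: `(1, i)` for `i < q^k`, `(q (i − q^k), 1)` otherwise. [folklore] -/
def colQN (i : ℕ) : ℤ × ℤ := if i < q ^ k then (1, i) else ((q * (i - q ^ k) : ℕ), 1)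

/-- Kernel-computable action of an integer matrix (as a quadruple) on indices. [cite: PopaZagier2017, §5] -/
def actQN (B : ℤ × ℤ × ℤ × ℤ) (i : ℕ) : ℕ :=
  idxQN q k (B.1 * (colQN q k i).1 + B.2.1 * (colQN q k i).2) (B.2.2.1 * (colQN q k i).1 + B.2.2.2 * (colQN q k i).2)

/-- Conjugation partner index (`(a, c) ↦ (a, -c)`). [folklore] -/
def iotaQN (i : ℕ) : ℕ := idxQN q k (colQN q k i).1 (-(colQN q k i).2)

/-! ## §2 `ℙ¹(ℤ/q^k)` by indices -/

/-- The index of the column `(a, c)` of residues modulo `q^k`. [cite: CremonaAlgorithms1997, §2.2] -/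
def idxQ (a c : ZMod (q ^ k)) : ℕ :=
  if Nat.Coprime a.val (q ^ k) then (c * a ^ (q ^ k - q ^ k / q - 1)).val
  else q ^ k + (a * c ^ (q ^ k - q ^ k / q - 1)).val / q

/-- The column of an index, modulo `q^k`. [folklore] -/
def colQ (i : ℕ) : Fin 2 → ZMod (q ^ k) :=
  if i < q ^ k then ![1, (i : ZMod (q ^ k))] else ![((q * (i - q ^ k) : ℕ) : ZMod (q ^ k)), 1]

/-- `colQ i` is unimodular. [folklore] -/
theorem isCoprime_colQ (i : ℕ) : IsCoprime (colQ q k i 0) (colQ q k i 1) := by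
  unfold colQ
  split_ifs
  · simpa using isCoprime_one_left
  · simpa using isCoprime_one_right

/-- `colQ i` as a unimodular column. [folklore] -/
def colUQ (i : ℕ) : UniCol (q ^ k) := ⟨colQ q k i, isCoprime_colQ q k i⟩

/-- The index of `[B̄ · colQ i]`. [cite: PopaZagier2017, §5] -/
def actIdxQ (B : Matrix (Fin 2) (Fin 2) ℤ) (i : ℕ) : ℕ :=
  idxQ q k ((redMat (q ^ k) B *ᵥ colQ q k i) 0) ((redMat (q ^ k) B *ᵥ colQ q k i) 1)

/-- The index of the conjugate column `(a, -c)` of `colQ i = (a, c)`. [cite: CremonaAlgorithms1997, §2.1.4] -/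
def iotaIdxQ (i : ℕ) : ℕ := idxQ q k (colQ q k i 0) (-(colQ q k i 1))

end QDefs

section QPrime

variable (q k : ℕ) [hq : Fact q.Prime]

/-- `q^k` is non-zero. [folklore] -/
instance neZero_powQ : NeZero (q ^ k) := ⟨pow_ne_zero k hq.out.ne_zero⟩

/-- `φ(q^k) = q^k − q^k/q` for prime `q`. [folklore] -/
theorem totient_powQ : Nat.totient (q ^ k) = q ^ k - q ^ k / q := by
  rcases Nat.eq_zero_or_pos k with rfl | hk
  · simp [Nat.div_eq_of_lt hq.out.one_lt]
  · rw [Nat.totient_prime_pow hq.out hk]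
    obtain ⟨j, rfl⟩ := Nat.exists_eq_add_of_le' hk
    rw [Nat.add_sub_cancel, pow_succ, Nat.mul_div_cancel _ hq.out.pos, Nat.mul_sub, mul_one, mul_comm]

/-- Euler: `a^{φ − 1} · a = 1` for `a` with `(a.val, q^k) = 1`, `φ = q^k − q^k/q`. [folklore] -/
theorem pow_pred_mul_eq_one {a : ZMod (q ^ k)} (ha : Nat.Coprime a.val (q ^ k)) :
    a ^ (q ^ k - q ^ k / q - 1) * a = 1 := by
  have hu : IsUnit a := by rw [← ZMod.natCast_zmod_val a]; exact (ZMod.isUnit_iff_coprime _ _).mpr ha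
  obtain ⟨u, rfl⟩ := hu
  have hφ : (u : ZMod (q ^ k)) ^ (q ^ k - q ^ k / q) = 1 := by
    rw [← totient_powQ q k, ← Units.val_pow_eq_pow_val, ZMod.pow_totient, Units.val_one]
  have hpos : 0 < q ^ k - q ^ k / q := by
    have : q ^ k / q < q ^ k := Nat.div_lt_self (pow_pos hq.out.pos k) hq.out.one_lt
    omega
  rw [← pow_succ, Nat.sub_add_cancel hpos, hφ]

/-- A residue mod `q^k` not prime to `q^k` has `q ∣ val`, and then `k ≠ 0`. [folklore] -/
theorem dvd_val_of_not_coprime {a : ZMod (q ^ k)} (ha : ¬ Nat.Coprime a.val (q ^ k)) :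
    q ∣ a.val ∧ k ≠ 0 := by
  have hk : k ≠ 0 := by rintro rfl; exact ha (by simp)
  refine ⟨?_, hk⟩
  by_contra h
  exact ha (Nat.Coprime.pow_right k ((Nat.coprime_comm).mp ((Nat.Prime.coprime_iff_not_dvd hq.out).mpr h)))

omit hq in
/-- `q ∣ (a b).val` as soon as `q ∣ a.val` (`k ≠ 0`). [folklore] -/
theorem dvd_val_mul {a : ZMod (q ^ k)} (b : ZMod (q ^ k)) (ha : q ∣ a.val) (hk : k ≠ 0) : q ∣ (a * b).val := by
  rw [ZMod.val_mul]
  exact (Nat.dvd_mod_iff (dvd_pow_self q hk)).mpr (dvd_mul_of_dvd_left ha _)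

/-- In `ℤ/q^k` a unimodular column whose first entry is not a unit has a unit second entry. [folklore] -/
theorem coprime_val_of_isCoprime {a c : ZMod (q ^ k)} (h : IsCoprime a c) (ha : ¬ Nat.Coprime a.val (q ^ k)) :
    Nat.Coprime c.val (q ^ k) := by
  obtain ⟨hqa, hk⟩ := dvd_val_of_not_coprime q k ha
  by_contra hc
  obtain ⟨hqc, -⟩ := dvd_val_of_not_coprime q k hc
  obtain ⟨x, y, hxy⟩ := h
  have hdvd : q ∣ q ^ k := dvd_pow_self q hk
  have := congrArg (ZMod.castHom hdvd (ZMod q)) hxy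
  rw [map_add, map_mul, map_mul, map_one] at this
  have h0 : ∀ b : ZMod (q ^ k), q ∣ b.val → ZMod.castHom hdvd (ZMod q) b = 0 := by
    intro b hb
    rw [ZMod.castHom_apply, ZMod.cast_eq_val, ZMod.natCast_eq_zero_iff]
    exact hb
  rw [h0 a hqa, h0 c hqc, mul_zero, mul_zero, add_zero] at this
  exact zero_ne_one this

/-- `idxQ` takes values `< q^k + q^k/q`. [folklore] -/
theorem idxQ_lt (a c : ZMod (q ^ k)) : idxQ q k a c < q ^ k + q ^ k / q := by
  unfold idxQ
  split_ifs with ha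
  · exact lt_of_lt_of_le (ZMod.val_lt _) (Nat.le_add_right _ _)
  · obtain ⟨-, hk⟩ := dvd_val_of_not_coprime q k ha
    have hlt : (a * c ^ (q ^ k - q ^ k / q - 1)).val < q ^ k := ZMod.val_lt _
    have hM : q ^ k = q ^ k / q * q := (Nat.div_mul_cancel (dvd_pow_self q hk)).symm
    have : (a * c ^ (q ^ k - q ^ k / q - 1)).val / q < q ^ k / q := by
      rw [Nat.div_lt_iff_lt_mul hq.out.pos]
      rwa [← hM]
    omega

/-- **Every unimodular column is the column of its index**: `[v] = [colQ (idxQ v₀ v₁)]` in `ℙ¹(ℤ/q^k)`.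
[cite: CremonaAlgorithms1997, §2.2 Prop. 2.2.1] -/
theorem mk_eq_mk_colUQ (v : UniCol (q ^ k)) : P1.mk v = P1.mk (colUQ q k (idxQ q k (v.1 0) (v.1 1))) := by
  obtain ⟨w, hw⟩ := v
  rw [P1.mk_eq_mk_iff]
  change w 0 * colQ q k (idxQ q k (w 0) (w 1)) 1 = w 1 * colQ q k (idxQ q k (w 0) (w 1)) 0
  by_cases ha : Nat.Coprime (w 0).val (q ^ k)
  · have hlt : (w 1 * w 0 ^ (q ^ k - q ^ k / q - 1)).val < q ^ k := ZMod.val_lt _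
    have hi : idxQ q k (w 0) (w 1) = (w 1 * w 0 ^ (q ^ k - q ^ k / q - 1)).val := by rw [idxQ, if_pos ha]
    rw [hi, colQ, if_pos hlt, Matrix.cons_val_one, Matrix.cons_val_fin_one, Matrix.cons_val_zero, mul_one,
      ZMod.natCast_zmod_val, mul_comm, mul_assoc, pow_pred_mul_eq_one q k ha, mul_one]
  · have hc : Nat.Coprime (w 1).val (q ^ k) := coprime_val_of_isCoprime q k hw ha
    obtain ⟨hqa, hk⟩ := dvd_val_of_not_coprime q k ha
    have hi : idxQ q k (w 0) (w 1) = q ^ k + (w 0 * w 1 ^ (q ^ k - q ^ k / q - 1)).val / q := by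
      rw [idxQ, if_neg ha]
    have hge : ¬ q ^ k + (w 0 * w 1 ^ (q ^ k - q ^ k / q - 1)).val / q < q ^ k := not_lt.mpr (Nat.le_add_right _ _)
    have hdv : q ∣ (w 0 * w 1 ^ (q ^ k - q ^ k / q - 1)).val := dvd_val_mul q k _ hqa hk
    rw [hi, colQ, if_neg hge, Matrix.cons_val_one, Matrix.cons_val_fin_one, Matrix.cons_val_zero, mul_one,
      Nat.add_sub_cancel_left, Nat.mul_div_cancel' hdv, ZMod.natCast_zmod_val, mul_comm (w 0), ← mul_assoc,
      mul_comm (w 1), pow_pred_mul_eq_one q k hc, one_mul]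

/-! ### The computable layer agrees -/

/-- `((a mod q^k).toNat : ZMod (q^k)) = a`. [folklore] -/
theorem natCast_toNat_emodQ (a : ℤ) : (((a % (q ^ k : ℕ)).toNat : ℕ) : ZMod (q ^ k)) = (a : ZMod (q ^ k)) := by
  have h0 : 0 ≤ a % (q ^ k : ℕ) := Int.emod_nonneg _ (by exact_mod_cast (NeZero.ne (q ^ k)))
  have : (((a % (q ^ k : ℕ)).toNat : ℕ) : ℤ) = a % (q ^ k : ℕ) := Int.toNat_of_nonneg h0
  rw [← Int.cast_natCast, this, ZMod.intCast_mod]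

/-- `(a mod q^k).toNat = (a : ZMod (q^k)).val`. [folklore] -/
theorem toNat_emodQ_eq_val (a : ℤ) : (a % (q ^ k : ℕ)).toNat = (a : ZMod (q ^ k)).val := by
  have h := ZMod.val_intCast (n := q ^ k) a
  have h0 : 0 ≤ a % (q ^ k : ℕ) := Int.emod_nonneg _ (by exact_mod_cast (NeZero.ne (q ^ k)))
  have : (((a % (q ^ k : ℕ)).toNat : ℕ) : ℤ) = ((a : ZMod (q ^ k)).val : ℤ) := by
    rw [Int.toNat_of_nonneg h0, h]
  exact_mod_cast this

/-- **`idxQN = idxQ`**: the `ℕ`-computation is the index. [folklore] -/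
theorem idxQN_eq_idxQ (a c : ℤ) : idxQN q k a c = idxQ q k (a : ZMod (q ^ k)) (c : ZMod (q ^ k)) := by
  unfold idxQN idxQ
  rw [toNat_emodQ_eq_val, toNat_emodQ_eq_val]
  have e1 : ∀ (x y : ZMod (q ^ k)) (e : ℕ), (y.val * x.val ^ e) % q ^ k = (y * x ^ e).val := by
    intro x y e
    rw [← ZMod.val_natCast (n := q ^ k), Nat.cast_mul, Nat.cast_pow, ZMod.natCast_zmod_val, ZMod.natCast_zmod_val]
  split_ifs <;> rw [e1]

omit hq in
/-- `colQN` is `colQ`. [folklore] -/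
theorem colQ_eq (i : ℕ) :
    colQ q k i = ![((colQN q k i).1 : ZMod (q ^ k)), ((colQN q k i).2 : ZMod (q ^ k))] := by
  unfold colQ colQN
  split_ifs <;> simp

/-- **`actQN = actIdxQ`** on the matrix of the quadruple. [folklore] -/
theorem actQN_eq (B : ℤ × ℤ × ℤ × ℤ) (i : ℕ) : actQN q k B i = actIdxQ q k (toMat B) i := by
  rw [actQN, actIdxQ, idxQN_eq_idxQ, colQ_eq]
  congr 1 <;> simp [redMat, toMat, Matrix.mulVec, dotProduct, Fin.sum_univ_two]

/-- **`iotaQN = iotaIdxQ`**. [folklore] -/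
theorem iotaQN_eq (i : ℕ) : iotaQN q k i = iotaIdxQ q k i := by
  rw [iotaQN, iotaIdxQ, idxQN_eq_idxQ, colQ_eq]
  simp

end QPrime

end Summit.BirchSwinnertonDyer.BirchSwinnertonDyer.Theorems.KolyvaginDepthDoor.MSymbolCert

end
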